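import Mathlib
import Summits.AtomisticToContinuum.HydrodynamicLimit.Theorems.InformationPercolationEngineKickFairRelEquilibriumMesoReductionBSetup
import Summits.AtomisticToContinuum.HydrodynamicLimit.Theorems.SuperextensiveClosureCostBlockEntropyBudgetTilt
import Summits.AtomisticToContinuum.HydrodynamicLimit.Theorems.JParityClosureOddContactSymmetryGibbsInvariance
import Literature.Probability.Process.CondExpInvariance
import HarnessLib

/-!
# `KickFairRelEquilibriumMeso`, line `condition-the-past` — B1 at CONSTANT profiles: `betaLG_const_ae_eq_zero`

Prover file (`--supports stmt-AtomisticToContinuum-15177`) for the registered sub-goal `betaLG_const_ae_eq_zero` of the line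
`condition-the-past` (lead c7, wave 3) of the crux
`Summit.AtomisticToContinuum.HydrodynamicLimit.Theses.InformationPercolationEngine.KickFairRelEquilibriumMeso`:
for CONSTANT profiles `(a, u, θ)` the `LG`-conditional bias `β_{i,n} = E_{LG}[D_{i,n} | σ(P_{i,n})]` of every kick vanishes
`LG`-almost surely.

Mechanism. For constant profiles the local Gibbs law `LG = localGibbsLaw σ a u θ` is the invariant law
`G = localGibbsLaw σ 1 0 1` tilted by the explicit density `(Z_G/Z_LG) ∏ᵢ f(zᵢ)/f_e(zᵢ)`
(`localGibbsLaw_eq_withDensity_localGibbsLaw_const`), a function of the VELOCITIES only, through the homogeneous Gibbs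
weights `∏ᵢ a M_{u,θ}(vᵢ)`, `∏ᵢ M_{0,1}(vᵢ)`; these weights are conserved along good orbits (energy and momentum
conservation, `tensorPow_localGibbsProfile_const_flow`), so the density at `z` equals the same expression evaluated on the
velocities at the flight-start time `s_i` of the kick `(i, n)` — and these velocities are recorded EXACTLY in the first photo
of the typed past `P_{i,n}` (`HardSphereFlow.coarsePastOf`). Hence on the good set (conull for `G`) the density is a Borel
function OF THE PAST, `F ∘ P_{i,n}` (`exists_measurable_tilt_eq_comp_past`), i.e. it is `σ(P_{i,n})`-measurable, and
conditional expectations given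
`σ(P_{i,n})` are the same under `LG` and `G` (Bayes invariance, `condExp_ae_eq_condExp_of_eq_withDensity`). Under `G` the
conditional expectation of `D = g(X) − κ`, `κ = E_G[g(X) | σ(P)]`, is `κ − κ = 0`; `LG ≪ G` moves this to `LG`.
-/

noncomputable section

open MeasureTheory Set Filter Topology
open scoped ENNReal Classical

namespace Summit.AtomisticToContinuum.HydrodynamicLimit.Theorems.KickFairRelEquilibriumMesoLine

open Literature.Analysis.FluidPDE Literature.MathematicalPhysics.KineticTheory Literature.Probability.Process

variable {σ : ℝ} {N : ℕ}

/-! ## The tilt `dLG/dG` at constant profiles is a Borel function of the typed past -/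

/-- **The tilt is conserved along good orbits and depends on the velocities only**: for `z` in the good set and every
time `t`, `∏ₖ f(zₖ)/f_e(zₖ)` (`f`, `f_e` the one-particle profiles at the constants `(a, u, θ)` and `(1, 0, 1)`) is the
ratio of the two homogeneous Gibbs weights of the configuration with the velocities of `Φ_t z` and all positions `0`
(energy and momentum conservation through `tensorPow_localGibbsProfile_const_flow`, and the closed form
`tensorPow_localGibbsProfile_const` of the homogeneous Gibbs weight, which sees the velocities only). [folklore] -/
theorem prod_profile_div_eq_tensorPow_vel_flow (a θ : ℝ) (u : V3) (Φ : Flow σ N) {z : Phase N} (hz : z ∈ Φ.good)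
    (t : ℝ) :
    ∏ k, localGibbsProfile (fun _ => a) (fun _ => u) (fun _ => θ) (z k) /
        localGibbsProfile (fun _ => 1) (fun _ => 0) (fun _ => 1) (z k) =
      tensorPow (N + 1) (localGibbsProfile (fun _ => a) (fun _ => u) (fun _ => θ))
          (fun k => ((0 : T3), (Φ.flow t z k).2)) /
        tensorPow (N + 1) (localGibbsProfile (fun _ => 1) (fun _ => 0) (fun _ => 1))
          (fun k => ((0 : T3), (Φ.flow t z k).2)) := by
  rw [Finset.prod_div_distrib]
  change tensorPow (N + 1) (localGibbsProfile (fun _ => a) (fun _ => u) (fun _ => θ)) z /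
      tensorPow (N + 1) (localGibbsProfile (fun _ => 1) (fun _ => 0) (fun _ => 1)) z = _
  rw [← tensorPow_localGibbsProfile_const_flow a θ u Φ hz t, ← tensorPow_localGibbsProfile_const_flow 1 1 0 Φ hz t]
  simp only [tensorPow_localGibbsProfile_const]

/-- **The tilt `dLG/dG` at constant profiles is a Borel function OF THE TYPED PAST on the good set**: there is a measurable
`F : Past N → ℝ` (explicitly: `(Z_G/Z_LG)` times the ratio of the two homogeneous Gibbs weights of the exact velocities
recorded in the FIRST photo `p.1.1.1` of `p : Past N`) such that for every flow, mesh `r`, good `z`, sphere `i` and index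
`n`, `(Z_G/Z_LG) ∏ₖ f(zₖ)/f_e(zₖ) = F (P_{i,n}(z))` — the first photo of `P_{i,n}` is the coarse configuration at the
flight start `s_i`, whose velocities are exact, and the tilt is the conserved velocity functional evaluated there.
[folklore] -/
theorem exists_measurable_tilt_eq_comp_past (σ : ℝ) (N : ℕ) (a θ : ℝ) (u : V3) :
    ∃ F : Past N → ℝ, Measurable F ∧ ∀ (Φ : Flow σ N) (r : ℝ) (z : Phase N), z ∈ Φ.good →
      ∀ (i : Fin (N + 1)) (n : ℕ),
        canonicalPartition (Torus.geometry (Fin 3)) (hsDiameter σ N) (N + 1)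
              (localGibbsProfile (fun _ => 1) (fun _ => 0) (fun _ => 1)) /
            canonicalPartition (Torus.geometry (Fin 3)) (hsDiameter σ N) (N + 1)
              (localGibbsProfile (fun _ => a) (fun _ => u) (fun _ => θ)) *
          ∏ k, localGibbsProfile (fun _ => a) (fun _ => u) (fun _ => θ) (z k) /
            localGibbsProfile (fun _ => 1) (fun _ => 0) (fun _ => 1) (z k) =
        F (past Φ r z i n) := by
  have hV : Measurable fun p : Past N => (fun k => ((0 : T3), (p.1.1.1 k).2) : Phase N) :=
    measurable_pi_lambda _ fun k =>
      measurable_const.prodMk ((measurable_pi_apply k).comp measurable_fst.fst.fst).snd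
  have hf : Measurable (localGibbsProfile (fun _ : T3 => a) (fun _ : T3 => u) (fun _ : T3 => θ)) :=
    measurable_localGibbsProfile continuous_const continuous_const continuous_const
  have hfe : Measurable (localGibbsProfile (fun _ : T3 => (1 : ℝ)) (fun _ : T3 => (0 : V3)) (fun _ : T3 => (1 : ℝ))) :=
    measurable_localGibbsProfile continuous_const continuous_const continuous_const
  refine ⟨fun p => canonicalPartition (Torus.geometry (Fin 3)) (hsDiameter σ N) (N + 1)
        (localGibbsProfile (fun _ => 1) (fun _ => 0) (fun _ => 1)) /
      canonicalPartition (Torus.geometry (Fin 3)) (hsDiameter σ N) (N + 1)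
        (localGibbsProfile (fun _ => a) (fun _ => u) (fun _ => θ)) *
      (tensorPow (N + 1) (localGibbsProfile (fun _ => a) (fun _ => u) (fun _ => θ))
          (fun k => ((0 : T3), (p.1.1.1 k).2)) /
        tensorPow (N + 1) (localGibbsProfile (fun _ => 1) (fun _ => 0) (fun _ => 1))
          (fun k => ((0 : T3), (p.1.1.1 k).2))), ?_, ?_⟩
  · exact measurable_const.mul (((measurable_tensorPow hf (N + 1)).comp hV).div
      ((measurable_tensorPow hfe (N + 1)).comp hV))
  · intro Φ r z hz i n
    -- the first photo of `P_{i,n}` carries the exact velocities at the flight start `s_i`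
    have hphoto : (fun k => ((0 : T3), ((past Φ r z i n).1.1.1 k).2) : Phase N) = fun k => ((0 : T3),
        (Φ.flow (flightStart (Torus.geometry (Fin 3)) (hsDiameter σ N) (fun s => Φ.flow s z) 0 i
          (Φ.nthCollisionTimeOf i n z)) z k).2) := by
      funext k
      simp only [past, hz, if_true, HardSphereFlow.coarsePastOf, coarseConfig_apply]
    dsimp only
    rw [hphoto]
    exact congrArg _ (prod_profile_div_eq_tensorPow_vel_flow a θ u Φ hz _)

/-- **`LG = (F ∘ P_{i,n}) • G` at constant profiles**: for `a, θ > 0` and `σ ≤ 1/2`, the local Gibbs law with constant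
profiles `(a, u, θ)` is the invariant law `G = localGibbsLaw σ 1 0 1` with a density `F ∘ P_{i,n}` that is a Borel
function of the typed past of ANY kick `(i, n)` (the explicit tilt of `localGibbsLaw_eq_withDensity_localGibbsLaw_const`,
modified on the `G`-null bad set through `exists_measurable_tilt_eq_comp_past`). [folklore] -/
theorem exists_localGibbsLaw_const_eq_withDensity_comp_past {a θ : ℝ} (ha : 0 < a) (hθ : 0 < θ) (u : V3)
    (hσ2 : σ ≤ 1 / 2) (Φ : Flow σ N) (r : ℝ) (i : Fin (N + 1)) (n : ℕ) :
    ∃ F : Past N → ℝ, Measurable F ∧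
      localGibbsLaw σ (fun _ => a) (fun _ => u) (fun _ => θ) N Φ =
        (localGibbsLaw σ (fun _ => 1) (fun _ => 0) (fun _ => 1) N Φ).withDensity
          fun z => ENNReal.ofReal (F (past Φ r z i n)) := by
  obtain ⟨F, hFm, hF⟩ := exists_measurable_tilt_eq_comp_past σ N a θ u
  refine ⟨F, hFm, (localGibbsLaw_eq_withDensity_localGibbsLaw_const (a₀ := fun _ => a) (θ₀ := fun _ => θ)
    (u₀ := fun _ => u) (θe := 1) continuous_const continuous_const continuous_const (fun _ => ha)
    (fun _ => hθ) one_pos hσ2 N Φ).trans (withDensity_congr_ae ?_)⟩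
  have hgood : ∀ᵐ z ∂(localGibbsLaw σ (fun _ => (1 : ℝ)) (fun _ => (0 : V3)) (fun _ => (1 : ℝ)) N Φ), z ∈ Φ.good :=
    mem_ae_iff.2 (localGibbsLaw_compl_good_eq_zero Φ)
  filter_upwards [hgood] with z hz
  rw [hF Φ r z hz i n]

/-! ## The conditional bias vanishes at constant profiles -/

/-- **Under the invariant law the conditional bias vanishes**: `E_G[D_{i,n} | σ(P_{i,n})] = 0` `G`-a.e., because
`D = g(X) − κ` with `κ = E_G[g(X) | σ(P)]` `σ(P)`-measurable and integrable (`condExp_sub`,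
`condExp_of_stronglyMeasurable`). [folklore] -/
theorem condExp_kickDev_invariant_ae_eq_zero (hσ2 : σ ≤ 1 / 2) (Φ : Flow σ N) (r : ℝ) {g : V3 × V3 × V3 → ℝ}
    (hg : Continuous g) {C : ℝ} (hC : ∀ p, |g p| ≤ C) (i : Fin (N + 1)) (n : ℕ) :
    (localGibbsLaw σ (fun _ => 1) (fun _ => 0) (fun _ => 1) N Φ)[kickDev Φ r g i n | pastSA Φ r i n]
      =ᵐ[localGibbsLaw σ (fun _ => 1) (fun _ => 0) (fun _ => 1) N Φ] 0 := by
  haveI : IsProbabilityMeasure (localGibbsLaw σ (fun _ => (1 : ℝ)) (fun _ => (0 : V3)) (fun _ => (1 : ℝ)) N Φ) :=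
    isProbabilityMeasure_localGibbsLaw continuous_const continuous_const continuous_const
      (fun _ => one_pos) (fun _ => one_pos) hσ2 N Φ
  have hGm : Measurable fun z => g (kick Φ i n z) := hg.measurable.comp (measurable_kick Φ i n)
  have hGi : Integrable (fun z => g (kick Φ i n z))
      (localGibbsLaw σ (fun _ => 1) (fun _ => 0) (fun _ => 1) N Φ) :=
    Integrable.of_bound hGm.aestronglyMeasurable C (Eventually.of_forall fun z => by
      simpa [Real.norm_eq_abs] using hC (kick Φ i n z))
  have hκsm : StronglyMeasurable[pastSA Φ r i n] (kappa Φ r g i n) := by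
    unfold kappa
    exact stronglyMeasurable_condExp
  have hκi : Integrable (kappa Φ r g i n) (localGibbsLaw σ (fun _ => 1) (fun _ => 0) (fun _ => 1) N Φ) := by
    unfold kappa
    exact integrable_condExp
  have h1 : (localGibbsLaw σ (fun _ => 1) (fun _ => 0) (fun _ => 1) N Φ)[kickDev Φ r g i n | pastSA Φ r i n]
      =ᵐ[localGibbsLaw σ (fun _ => 1) (fun _ => 0) (fun _ => 1) N Φ]
      (localGibbsLaw σ (fun _ => 1) (fun _ => 0) (fun _ => 1) N Φ)[(fun z => g (kick Φ i n z)) | pastSA Φ r i n] -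
        (localGibbsLaw σ (fun _ => 1) (fun _ => 0) (fun _ => 1) N Φ)[kappa Φ r g i n | pastSA Φ r i n] := by
    have : kickDev Φ r g i n = (fun z => g (kick Φ i n z)) - kappa Φ r g i n := rfl
    rw [this]
    exact condExp_sub hGi hκi _
  have h2 : (localGibbsLaw σ (fun _ => 1) (fun _ => 0) (fun _ => 1) N Φ)[kappa Φ r g i n | pastSA Φ r i n] =
      kappa Φ r g i n := condExp_of_stronglyMeasurable (pastSA_le Φ r i n) hκsm hκi
  have h3 : (localGibbsLaw σ (fun _ => 1) (fun _ => 0) (fun _ => 1) N Φ)[(fun z => g (kick Φ i n z)) | pastSA Φ r i n] =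
      kappa Φ r g i n := rfl
  filter_upwards [h1] with z hz
  rw [hz, Pi.sub_apply, h2, h3, sub_self, Pi.zero_apply]

/-- **B1 at constant profiles, fixed data** (`σ ≤ 1/2`, `a, θ > 0`, bounded continuous `g`): the `LG`-conditional bias
`β_{i,n} = E_{LG}[D_{i,n} | σ(P_{i,n})]` vanishes `LG`-a.e. — `LG = (F ∘ P_{i,n}) • G` with a `σ(P_{i,n})`-measurable
density (`exists_localGibbsLaw_const_eq_withDensity_comp_past`), so `E_{LG}[· | σ(P_{i,n})] = E_G[· | σ(P_{i,n})]`
`LG`-a.e. (`condExp_ae_eq_condExp_of_eq_withDensity`), and the latter of `D` is `0`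
(`condExp_kickDev_invariant_ae_eq_zero`, moved to `LG` by `LG ≪ G`). [folklore] -/
theorem betaLG_const_ae_eq_zero_of {a θ : ℝ} (ha : 0 < a) (hθ : 0 < θ) (u : V3) (hσ2 : σ ≤ 1 / 2) (Φ : Flow σ N)
    (r : ℝ) {g : V3 × V3 × V3 → ℝ} (hg : Continuous g) {C : ℝ} (hC : ∀ p, |g p| ≤ C) (i : Fin (N + 1)) (n : ℕ) :
    betaLG σ (fun _ => a) (fun _ => θ) (fun _ => u) Φ r g i n
      =ᵐ[localGibbsLaw σ (fun _ => a) (fun _ => u) (fun _ => θ) N Φ] 0 := by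
  haveI : IsProbabilityMeasure (localGibbsLaw σ (fun _ => (1 : ℝ)) (fun _ => (0 : V3)) (fun _ => (1 : ℝ)) N Φ) :=
    isProbabilityMeasure_localGibbsLaw continuous_const continuous_const continuous_const
      (fun _ => one_pos) (fun _ => one_pos) hσ2 N Φ
  haveI : IsProbabilityMeasure (localGibbsLaw σ (fun _ => a) (fun _ => u) (fun _ => θ) N Φ) :=
    isProbabilityMeasure_localGibbsLaw continuous_const continuous_const continuous_const
      (fun _ => ha) (fun _ => hθ) hσ2 N Φ
  -- the density `F ∘ P_{i,n}` of `LG` w.r.t. `G` is `σ(P_{i,n})`-measurable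
  obtain ⟨F, hFm, hLG⟩ := exists_localGibbsLaw_const_eq_withDensity_comp_past ha hθ u hσ2 Φ r i n
  have hρ : Measurable[pastSA Φ r i n] fun z => ENNReal.ofReal (F (past Φ r z i n)) :=
    (hFm.comp (comap_measurable fun z => past Φ r z i n)).ennreal_ofReal
  -- integrability of `D` under both laws (`|D| ≤ 2C` a.e.)
  have hDG : Integrable (kickDev Φ r g i n) (localGibbsLaw σ (fun _ => 1) (fun _ => 0) (fun _ => 1) N Φ) :=
    Integrable.of_bound (measurable_kickDev Φ r hg i n).aestronglyMeasurable (2 * C)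
      ((ae_forall_abs_kickDev_le (a₀ := fun _ => 1) (θ₀ := fun _ => 1) (u₀ := fun _ => 0) hσ2 Φ r hC).mono
        fun z hz => by simpa [Real.norm_eq_abs] using hz i n)
  have hDLG : Integrable (kickDev Φ r g i n) (localGibbsLaw σ (fun _ => a) (fun _ => u) (fun _ => θ) N Φ) :=
    Integrable.of_bound (measurable_kickDev Φ r hg i n).aestronglyMeasurable (2 * C)
      ((ae_forall_abs_kickDev_le (a₀ := fun _ => a) (θ₀ := fun _ => θ) (u₀ := fun _ => u) hσ2 Φ r hC).mono
        fun z hz => by simpa [Real.norm_eq_abs] using hz i n)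
  -- Bayes invariance of the conditional expectation, then the invariant-law computation moved to `LG`
  have hBayes : (localGibbsLaw σ (fun _ => a) (fun _ => u) (fun _ => θ) N Φ)[kickDev Φ r g i n | pastSA Φ r i n]
      =ᵐ[localGibbsLaw σ (fun _ => a) (fun _ => u) (fun _ => θ) N Φ]
      (localGibbsLaw σ (fun _ => 1) (fun _ => 0) (fun _ => 1) N Φ)[kickDev Φ r g i n | pastSA Φ r i n] :=
    condExp_ae_eq_condExp_of_eq_withDensity (pastSA_le Φ r i n) hρ hLG hDG hDLG
  exact hBayes.trans ((localGibbsLaw_ac_invariant hσ2 Φ).ae_eq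
    (condExp_kickDev_invariant_ae_eq_zero hσ2 Φ r hg hC i n))

/-- **B1 at CONSTANT profiles** (registered sub-goal `betaLG_const_ae_eq_zero` of the line `condition-the-past`): for every
cell sequence `rseq`, constants `a, θ > 0`, `u`, every `0 < σ ≤ 1/2`, particle number, flow, bounded continuous `g`, sphere
`i` and index `n`, the `LG`-conditional bias `betaLG σ a θ u Φ (rseq N) g i n = E_{LG}[D_{i,n} | σ(P_{i,n})]` vanishes
almost surely under the (constant-profile) local Gibbs law: its density w.r.t. the invariant law is a function of the
conserved energy and momentum, read off the exact flight-start velocities in the typed past. [folklore] -/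
theorem betaLG_const_ae_eq_zero : ∀ (rseq : ℕ → ℝ) (a θ : ℝ) (u : V3), 0 < a → 0 < θ → ∀ (σ : ℝ), 0 < σ → σ ≤ 1 / 2 → ∀ (N : ℕ) (Φ : Flow σ N) (g : V3 × V3 × V3 → ℝ), Continuous g → (∃ C : ℝ, ∀ p, |g p| ≤ C) → ∀ (i : Fin (N + 1)) (n : ℕ), betaLG σ (fun _ => a) (fun _ => θ) (fun _ => u) Φ (rseq N) g i n =ᵐ[localGibbsLaw σ (fun _ => a) (fun _ => u) (fun _ => θ) N Φ] 0 := by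
  intro rseq a θ u ha hθ σ _hσ hσ2 N Φ g hg hgb i n
  obtain ⟨C, hC⟩ := hgb
  exact betaLG_const_ae_eq_zero_of ha hθ u hσ2 Φ (rseq N) hg hC i n

end Summit.AtomisticToContinuum.HydrodynamicLimit.Theorems.KickFairRelEquilibriumMesoLine

end
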